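import Mathlib.Analysis.Calculus.ContDiff.Deriv
import Literature.Analysis.FunctionSpaces.TorusCalculusProofs
import Literature.Analysis.FunctionSpaces.TorusFluidGlueProofs
import HarnessLib

/-!
# Stub `stub_eddyEnergyOnStreamline` of the line `SketchIdeator2` (card `separatrix-flux-pinning`)
# (crux stmt-AnomalousDissipation-14249, `MarginalStabilityChain.ChainRealisation`)

The **eddy-energy floor on a mean streamline**.  On the flat torus `T²` let `W` be the mean axial
velocity, `V = ∇⊥Ψ` the mean planar velocity, `T` the eddy flux of axial momentum with a pointwise
majorant `‖T‖ ≤ k`, and `h` the axial source, satisfying the weak stationary balance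
`∫ (W ⟪V, ∇ψ⟫ + ⟪T, ∇ψ⟫ + ν W Δψ + h ψ) = 0` for every smooth test function `ψ`.  ASSUMING the
Rhines–Young identity with source (the neighbouring stub `stub_pinnedSeparatrixFlux`, taken here
verbatim as the first hypothesis),
`∫ G'(Ψ) ⟪T, ∇Ψ⟫ = -∫ h G(Ψ) - ν ∫ W Δ(G ∘ Ψ)` for smooth `G`,
one gets for every smooth monotone `G` (`G' ≥ 0`) the floor
`|∫ h G(Ψ)| ≤ ∫ G'(Ψ) k ‖∇Ψ‖ + |ν| |∫ W Δ(G ∘ Ψ)|`.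

Proof: rearrange the identity to `∫ h G(Ψ) = -(∫ G'(Ψ)⟪T,∇Ψ⟫) - ν ∫ W Δ(G∘Ψ)`, take absolute values
(`abs_add_le`, `abs_mul`), and bound the flux integral pointwise,
`|G'(Ψ x) ⟪T x, ∇Ψ x⟫| = G'(Ψ x) |⟪T x, ∇Ψ x⟫| ≤ G'(Ψ x) ‖T x‖ ‖∇Ψ x‖ ≤ G'(Ψ x) k x ‖∇Ψ x‖`
(Cauchy–Schwarz `abs_real_inner_le_norm`), then `MeasureTheory.norm_integral_le_of_norm_le`; the
majorant is continuous on the compact torus (`ContDiff.continuous_deriv`, `IsSmooth.gradient`), hence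
integrable (`Continuous.integrable_unitAddTorus`).

The statement is the registered stub verbatim, over the skeleton's local notations
`𝕋² = UnitAddTorus (Fin 2)`, `E² = EuclideanSpace ℝ (Fin 2)`; `gradient`, `laplacian`, `partialDeriv`,
`IsSmooth` are the torus notions of `Literature.Analysis.FunctionSpaces.Torus` (checked by the two
`example`s below).

References: P. B. Rhines and W. R. Young, *Homogenization of potential vorticity in planetary gyres*,
J. Fluid Mech. 122 (1982), §2; torus calculus of
`Literature/Analysis/FunctionSpaces/TorusCalculus(Proofs).lean`.
-/

-- `Summit.<Summit>.<Problem>` is the tree's mandated summit-side namespace (CONVENTIONS §2); for this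
-- single-conjunct summit the two coincide, so the duplicate is deliberate.
set_option linter.dupNamespace false

noncomputable section

open MeasureTheory Set Filter Topology
open scoped InnerProductSpace
open Literature.Analysis.FunctionSpaces Literature.Analysis.FunctionSpaces.Torus

namespace Summit.AnomalousDissipation.AnomalousDissipation.Theorems.ChainRealisation.SeparatrixFluxPinning

/-- Local notation (as in the skeleton): the planar torus `T²`. -/
local notation "𝕋²" => UnitAddTorus (Fin 2)
/-- Local notation (as in the skeleton): planar velocity values. -/
local notation "E²" => EuclideanSpace ℝ (Fin 2)

/-- Sanity check: with the opens above, `gradient` on torus functions is `Torus.gradient`. -/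
example : (gradient : (𝕋² → ℝ) → 𝕋² → E²) = Torus.gradient := rfl

/-- Sanity check: with the opens above, `laplacian` on torus functions is `Torus.laplacian`. -/
example : (laplacian : (𝕋² → ℝ) → 𝕋² → ℝ) = Torus.laplacian := rfl

/-- Pointwise Cauchy–Schwarz bound for the eddy-flux integrand: if `0 ≤ a` and `‖T‖ ≤ k` then
`‖a ⟪T, w⟫‖ ≤ a k ‖w‖`. -/
private theorem stub_eddyEnergyOnStreamline_pointwise {a kx : ℝ} {Tx w : E²} (ha : 0 ≤ a)
    (hT : ‖Tx‖ ≤ kx) : ‖a * ⟪Tx, w⟫_ℝ‖ ≤ a * kx * ‖w‖ := by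
  rw [Real.norm_eq_abs, abs_mul, abs_of_nonneg ha, mul_assoc]
  refine mul_le_mul_of_nonneg_left ?_ ha
  calc |⟪Tx, w⟫_ℝ| ≤ ‖Tx‖ * ‖w‖ := abs_real_inner_le_norm _ _
    _ ≤ kx * ‖w‖ := mul_le_mul_of_nonneg_right hT (norm_nonneg _)

/-- Elementary step: if `B = -A - ν C` and `|A| ≤ M` then `|B| ≤ M + |ν| |C|`. -/
private theorem stub_eddyEnergyOnStreamline_abs {A B C ν M : ℝ} (hB : B = -A - ν * C)
    (hA : |A| ≤ M) : |B| ≤ M + |ν| * |C| := by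
  have h1 : |B| = |A + ν * C| := by
    rw [hB, show -A - ν * C = -(A + ν * C) by ring, abs_neg]
  calc |B| = |A + ν * C| := h1
    _ ≤ |A| + |ν * C| := abs_add_le _ _
    _ = |A| + |ν| * |C| := by rw [abs_mul]
    _ ≤ M + |ν| * |C| := by linarith

/-- **Eddy-energy floor on a mean streamline** (`PinnedSeparatrixFlux → EddyEnergyOnStreamline` of the
sketch `SketchIdeator2`, card `separatrix-flux-pinning`): assuming the Rhines–Young identity with source
`∫ G'(Ψ)⟪T,∇Ψ⟫ = -∫ h G(Ψ) - ν ∫ W Δ(G∘Ψ)` for the stationary mean objects `(ν, h, W, Ψ, V, T)` on `T²`,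
a pointwise majorant `‖T‖ ≤ k` of the eddy flux and a smooth monotone `G` (`G' ≥ 0`) give
`|∫ h G(Ψ)| ≤ ∫ G'(Ψ) k ‖∇Ψ‖ + |ν| |∫ W Δ(G∘Ψ)|`
(Cauchy–Schwarz pointwise and `norm_integral_le_of_norm_le`; Rhines–Young 1982, §2). -/
theorem stub_eddyEnergyOnStreamline :
    (∀ (ν : ℝ) (h W Ψ : 𝕋² → ℝ) (V T : 𝕋² → E²),
      IsSmooth h → IsSmooth W → IsSmooth Ψ → IsSmooth V → IsSmooth T →
      (∀ x, V x 0 = partialDeriv 1 Ψ x ∧ V x 1 = -partialDeriv 0 Ψ x) →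
      (∀ ψ : 𝕋² → ℝ, IsSmooth ψ →
        ∫ x, (W x * ⟪V x, gradient ψ x⟫_ℝ + ⟪T x, gradient ψ x⟫_ℝ + ν * (W x * laplacian ψ x) +
          h x * ψ x) = 0) →
      ∀ G : ℝ → ℝ, ContDiff ℝ (⊤ : ℕ∞) G →
        ∫ x, deriv G (Ψ x) * ⟪T x, gradient Ψ x⟫_ℝ =
          -(∫ x, h x * G (Ψ x)) - ν * ∫ x, W x * laplacian (G ∘ Ψ) x) →
    ∀ (ν : ℝ) (h W Ψ k : 𝕋² → ℝ) (V T : 𝕋² → E²) (G : ℝ → ℝ),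
      IsSmooth h → IsSmooth W → IsSmooth Ψ → IsSmooth V → IsSmooth T → Continuous k →
      ContDiff ℝ (⊤ : ℕ∞) G → (∀ s, 0 ≤ deriv G s) → (∀ x, ‖T x‖ ≤ k x) →
      (∀ x, V x 0 = partialDeriv 1 Ψ x ∧ V x 1 = -partialDeriv 0 Ψ x) →
      (∀ ψ : 𝕋² → ℝ, IsSmooth ψ →
        ∫ x, (W x * ⟪V x, gradient ψ x⟫_ℝ + ⟪T x, gradient ψ x⟫_ℝ + ν * (W x * laplacian ψ x) +
          h x * ψ x) = 0) →
      |∫ x, h x * G (Ψ x)| ≤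
        (∫ x, deriv G (Ψ x) * k x * ‖gradient Ψ x‖) + |ν| * |∫ x, W x * laplacian (G ∘ Ψ) x| := by
  intro hPinned ν h W Ψ k V T G hh hW hΨ hV hT hk hG hG' hTk hVΨ hbal
  -- the Rhines–Young identity at `(ν, h, W, Ψ, V, T)` and `G`
  have hid : ∫ x, deriv G (Ψ x) * ⟪T x, gradient Ψ x⟫_ℝ =
      -(∫ x, h x * G (Ψ x)) - ν * ∫ x, W x * laplacian (G ∘ Ψ) x :=
    hPinned ν h W Ψ V T hh hW hΨ hV hT hVΨ hbal G hG
  -- the majorant `G'(Ψ) k ‖∇Ψ‖` is continuous on the compact torus, hence integrable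
  have hG1 : Continuous (deriv G) := hG.continuous_deriv (mod_cast le_top)
  have hint : Integrable (fun x : 𝕋² => deriv G (Ψ x) * k x * ‖gradient Ψ x‖) volume := by
    refine Continuous.integrable_unitAddTorus ?_
    exact ((hG1.comp hΨ.continuous).mul hk).mul hΨ.gradient.continuous.norm
  -- pointwise Cauchy–Schwarz, then the integral triangle inequality
  have hpt : ∀ x : 𝕋², ‖deriv G (Ψ x) * ⟪T x, gradient Ψ x⟫_ℝ‖ ≤
      deriv G (Ψ x) * k x * ‖gradient Ψ x‖ :=
    fun x => stub_eddyEnergyOnStreamline_pointwise (hG' (Ψ x)) (hTk x)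
  have hA : |∫ x, deriv G (Ψ x) * ⟪T x, gradient Ψ x⟫_ℝ| ≤
      ∫ x, deriv G (Ψ x) * k x * ‖gradient Ψ x‖ := by
    have := norm_integral_le_of_norm_le hint (Eventually.of_forall hpt)
    rwa [Real.norm_eq_abs] at this
  have hB : ∫ x, h x * G (Ψ x) =
      -(∫ x, deriv G (Ψ x) * ⟪T x, gradient Ψ x⟫_ℝ) - ν * ∫ x, W x * laplacian (G ∘ Ψ) x := by
    linarith
  exact stub_eddyEnergyOnStreamline_abs hB hA

end Summit.AnomalousDissipation.AnomalousDissipation.Theorems.ChainRealisation.SeparatrixFluxPinning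

end
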